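import Mathlib
import HarnessLib
import Literature.Analysis.FluidPDE.SelfSimilar
import Literature.Analysis.FluidPDE.LocalTypeI
import Literature.Analysis.FluidPDE.VectorCalculus
import Literature.Analysis.FluidPDE.AxisymmetricEuler
import Literature.Analysis.UnboundedOperators.HeatKernel
import Summits.NavierStokesRegularity.NavierStokesRegularity.Theorems.PoloidalWindowDoorPoloidalWindowRigidityWindow
import Summits.NavierStokesRegularity.NavierStokesRegularity.Theorems.PoloidalWindowDoorPoloidalWindowRigidityRotate
import Summits.NavierStokesRegularity.NavierStokesRegularity.Theorems.PoloidalWindowDoorPoloidalWindowRigidityFirstIntegral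
import Summits.NavierStokesRegularity.NavierStokesRegularity.Theorems.PoloidalWindowDoorPoloidalWindowRigidityFlatHorizontal
import Summits.NavierStokesRegularity.NavierStokesRegularity.Theorems.PoloidalWindowDoorPoloidalWindowRigidityAxisymmetric
import Summits.NavierStokesRegularity.NavierStokesRegularity.Theorems.PoloidalWindowDoorPoloidalWindowRigidityDegenerate

/-!
# Route `PoloidalWindowDoor` (staged, nsreg-p1), crux `PoloidalWindowRigidity` (K2) — K2 reduced to the SHARPENED
# open residue (rotational, not vertically rigid, non-flat in every horizontal direction, not axisymmetric about
# any vertical axis)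

Cell ns-regularity-ideate, seat p6 (route-directed support; land `--supports <PoloidalWindowRigidity item>` once the
route is born). The birth skeleton reduces K2 to `stub_nonflatLiouville` (`…PoloidalWindowRigidity.
poloidalWindowRigidity_of_nonflatLiouville`). Four settled strata of that stub are tree theorems of this seat —
`…Degenerate.nonflatLiouville_of_irrotational` (R8-h, irrotational slices), `…Degenerate.nonflatLiouville_of_vertRigid`
(R8-f, horizontal velocity rigid in the vertical direction), `…FlatHorizontal.flatStratum_of_horizontal` (the first
integral `v·e₃` is independent of SOME horizontal direction) and `…Axisymmetric.nonflatLiouville_of_axisymmetric_translate`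
(slices axisymmetric about SOME vertical axis, KNSS Thm 5.2) — so K2 already follows from the SHARPENED residue

  `SharpNonflatLiouville`: a profile of the route's Type-I class that is poloidal along `e₃`, satisfies the frozen
  constraint `⟪Dv(s)(y) curl v(s)(y), e₃⟫ = 0`, is ROTATIONAL (`∃ s < 0, ∃ y, curl v(s)(y) ≠ 0`), is NOT vertically
  rigid (`∃ s < 0, ∃ y, (Dv(s)(y) e₃)₀ ≠ 0 ∨ (Dv(s)(y) e₃)₁ ≠ 0`), whose first integral `v·e₃` is flat in NO horizontal
  direction (`∀ a ≠ 0, ⟪a,e₃⟫ = 0 → ∃ s < 0, ∃ y, ⟪Dv(s)(y) a, e₃⟫ ≠ 0`) and whose slices are axisymmetric about NO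
  vertical axis (`∀ c, ∃ s < 0, ¬ IsAxisymmetric (v(s, · + c))`), is not backward-singular at the apex —

which is the Type-I-profile form of the planner's ROUND-9 target LRC-rc (R9-PREP §2: «ω₃ ≡ 0, rotational, ∂₃v_h ≢ 0,
v₃ non-flat ⟹ axisymmetric no-swirl modulo symmetries»). `poloidalWindowRigidity_of_sharpNonflatLiouville` is that
reduction (conclusion VERBATIM the K2 text); the lead may register its hypothesis as the reshaped stub.

WHAT THIS IS NOT: not a claim about Navier–Stokes regularity and not a proof of K2 — a kernel-checked reduction of K2 to
a sharper open residue, for a STAGED door route (bears_on LADDER-NS N0, rung N0-LocalTubeDoorPoloidal).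
-/

noncomputable section

-- the summit and its single sub-problem share the name (CONVENTIONS §1), as in every Theorems file
set_option linter.dupNamespace false

namespace Summit.NavierStokesRegularity.NavierStokesRegularity.Theorems.PoloidalWindowDoorPoloidalWindowRigiditySharp

open MeasureTheory Set Function Filter Topology TopologicalSpace Metric
open scoped RealInnerProductSpace InnerProductSpace
open Literature.Analysis Literature.Analysis.FluidPDE
open Summit.NavierStokesRegularity.NavierStokesRegularity.Theorems.PoloidalWindowDoorPoloidalWindowRigidityWindow
open Summit.NavierStokesRegularity.NavierStokesRegularity.Theorems.PoloidalWindowDoorPoloidalWindowRigidityRotate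
open Summit.NavierStokesRegularity.NavierStokesRegularity.Theorems.PoloidalWindowDoorPoloidalWindowRigidityFirstIntegral
open Summit.NavierStokesRegularity.NavierStokesRegularity.Theorems.PoloidalWindowDoorPoloidalWindowRigidityFlatHorizontal
open Summit.NavierStokesRegularity.NavierStokesRegularity.Theorems.PoloidalWindowDoorPoloidalWindowRigidityAxisymmetric
open Summit.NavierStokesRegularity.NavierStokesRegularity.Theorems.PoloidalWindowDoorPoloidalWindowRigidityDegenerate

/-- **K2 `PoloidalWindowRigidity` reduced to the sharpened open residue.** Hypothesis `h` = the residue described in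
the module docstring (class + poloidal along `e₃` + frozen constraint + rotational + not vertically rigid + flat in
NO horizontal direction + axisymmetric about NO vertical axis ⟹ not backward-singular); conclusion = the K2 text
VERBATIM. Proof: window ⇒ everywhere (`stub_windowToEverywhere`), WLOG `e = e₃` (`stub_rotate`), frozen constraint
(`stub_firstIntegral`), then the case split irrotational (`nonflatLiouville_of_irrotational`) / vertically rigid
(`nonflatLiouville_of_vertRigid`) / flat in some horizontal direction (`flatStratum_of_horizontal`) / axisymmetric
about some vertical axis (`nonflatLiouville_of_axisymmetric_translate`) / the residue `h`. -/
theorem poloidalWindowRigidity_of_sharpNonflatLiouville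
    (h : ∀ (C : ℝ) (v : ℝ → EuclideanSpace ℝ (Fin 3) → EuclideanSpace ℝ (Fin 3)),
      Literature.Analysis.FluidPDE.HasTypeITimeDecay C v →
      ContinuousOn (Function.uncurry v) (Set.Iio (0 : ℝ) ×ˢ Set.univ) →
      (∀ s t : ℝ, s < t → t < 0 → ∀ x, v t x =
        Literature.Analysis.UnboundedOperators.heatExtension (v s) (t - s) x -
          Literature.Analysis.FluidPDE.oseenDuhamel 1 s v v t x) →
      (∀ t < 0, Literature.Analysis.FluidPDE.VectorCalculus.IsDivFree (v t)) →
      (∀ s < 0, ∀ y, ⟪Literature.Analysis.FluidPDE.curl (v s) y, EuclideanSpace.single 2 1⟫_ℝ = 0) →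
      (∀ s < 0, ∀ y, ⟪fderiv ℝ (v s) y (Literature.Analysis.FluidPDE.curl (v s) y), EuclideanSpace.single 2 1⟫_ℝ = 0) →
      (∃ s < 0, ∃ y, Literature.Analysis.FluidPDE.curl (v s) y ≠ 0) →
      (∃ s < 0, ∃ y, fderiv ℝ (v s) y (EuclideanSpace.single 2 1) 0 ≠ 0 ∨
        fderiv ℝ (v s) y (EuclideanSpace.single 2 1) 1 ≠ 0) →
      (∀ a : EuclideanSpace ℝ (Fin 3), a ≠ 0 → ⟪a, EuclideanSpace.single 2 1⟫_ℝ = 0 →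
        ∃ s < 0, ∃ y, ⟪fderiv ℝ (v s) y a, EuclideanSpace.single 2 1⟫_ℝ ≠ 0) →
      (∀ c : EuclideanSpace ℝ (Fin 3), ∃ s < 0, ¬ Literature.Analysis.FluidPDE.IsAxisymmetric (fun y => v s (y + c))) →
      ¬ Literature.Analysis.FluidPDE.IsBackwardSingularPoint v 0) :
    ∀ (C : ℝ) (v : ℝ → EuclideanSpace ℝ (Fin 3) → EuclideanSpace ℝ (Fin 3)), Literature.Analysis.FluidPDE.HasTypeITimeDecay C v → ContinuousOn (Function.uncurry v) (Set.Iio (0 : ℝ) ×ˢ Set.univ) → (∀ s t : ℝ, s < t → t < 0 → ∀ x, v t x = Literature.Analysis.UnboundedOperators.heatExtension (v s) (t - s) x - Literature.Analysis.FluidPDE.oseenDuhamel 1 s v v t x) → (∀ t < 0, Literature.Analysis.FluidPDE.VectorCalculus.IsDivFree (v t)) → (∀ s < 0, Continuous (Literature.Analysis.FluidPDE.curl (v s))) ∧ ∀ (e : EuclideanSpace ℝ (Fin 3)), e ≠ 0 → (∀ s < 0, ∃ U : Set (EuclideanSpace ℝ (Fin 3)), IsOpen U ∧ U.Nonempty ∧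 ∀ y ∈ U, ⟪Literature.Analysis.FluidPDE.curl (v s) y, e⟫_ℝ = 0) → ¬ Literature.Analysis.FluidPDE.IsBackwardSingularPoint v 0 := by
  intro C v hrate hcont hmild hdiv
  refine ⟨(stub_windowToEverywhere C v hrate hcont hmild hdiv).1, fun e he hwin hsing => ?_⟩
  have hall : ∀ s < 0, ∀ y, ⟪Literature.Analysis.FluidPDE.curl (v s) y, e⟫_ℝ = 0 :=
    (stub_windowToEverywhere C v hrate hcont hmild hdiv).2 e he hwin
  obtain ⟨C', v', hrate', hcont', hmild', hdiv', hpol', hsing'⟩ :=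
    stub_rotate C v hrate hcont hmild hdiv e he hall hsing
  have hfi := stub_firstIntegral C' v' hrate' hcont' hmild' hdiv' (EuclideanSpace.single 2 1) hpol'
  by_cases hirr : ∀ s < 0, ∀ y, Literature.Analysis.FluidPDE.curl (v' s) y = 0
  · exact nonflatLiouville_of_irrotational hrate' hcont' hmild' hdiv' hirr hsing'
  by_cases hvr : ∀ s < 0, ∀ y, fderiv ℝ (v' s) y (EuclideanSpace.single 2 1) 0 = 0 ∧
      fderiv ℝ (v' s) y (EuclideanSpace.single 2 1) 1 = 0
  · exact nonflatLiouville_of_vertRigid hrate' hcont' hmild' hdiv' (fun s hs y => (hvr s hs y).1)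
      (fun s hs y => (hvr s hs y).2) hsing'
  by_cases hflat : ∃ a : EuclideanSpace ℝ (Fin 3), a ≠ 0 ∧ ⟪a, EuclideanSpace.single 2 1⟫_ℝ = 0 ∧
      ∀ s < 0, ∀ y, ⟪fderiv ℝ (v' s) y a, EuclideanSpace.single 2 1⟫_ℝ = 0
  · obtain ⟨a, ha, ha3, hfl⟩ := hflat
    exact flatStratum_of_horizontal hrate' hcont' hmild' hdiv' hpol' ha ha3 hfl hsing'
  by_cases haxi : ∃ c : EuclideanSpace ℝ (Fin 3), ∀ s < 0,
      Literature.Analysis.FluidPDE.IsAxisymmetric (fun y => v' s (y + c))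
  · obtain ⟨c, hc⟩ := haxi
    exact (nonflatLiouville_of_axisymmetric_translate c hrate' hcont' hmild' hdiv' hpol' hc).2 hsing'
  · push Not at hirr hvr hflat haxi
    refine h C' v' hrate' hcont' hmild' hdiv' hpol' hfi ?_ ?_ (fun a ha ha3 => ?_) haxi hsing'
    · obtain ⟨s, hs, y, hy⟩ := hirr
      exact ⟨s, hs, y, hy⟩
    · obtain ⟨s, hs, y, hy⟩ := hvr
      refine ⟨s, hs, y, ?_⟩
      by_cases h0 : fderiv ℝ (v' s) y (EuclideanSpace.single 2 1) 0 = 0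
      · exact Or.inr (hy h0)
      · exact Or.inl h0
    · obtain ⟨s, hs, y, hy⟩ := hflat a ha ha3
      exact ⟨s, hs, y, hy⟩

end Summit.NavierStokesRegularity.NavierStokesRegularity.Theorems.PoloidalWindowDoorPoloidalWindowRigiditySharp

end
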